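import Mathlib
import Literature.Geometry.DiscreteGeometry.KissingPatterns

/-!
# Crux `DisclinationRation.FiveFoldRation` (stmt-AtomisticToContinuum-15799), line `Sketch` —
# helpers for stub `stub_dr5_poleLemma` (pole lemma), part 1: pattern combinatorics

Trigonometry of the angles `2πk/5`, distances inside the decahedral pattern
`Deca = {±e₃} ∪ {(√3/2·cos(2πk/5), √3/2·sin(2πk/5), ±1/2)}`, and the three VALENCE FACTS:
in the cuboctahedron (fcc) and the anticuboctahedron (hcp) every vertex has at most four other
vertices at distance `< 7/5`, and in `Deca` only the two poles have five (a ring point has four).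
Helper prefix `dr5pl_`.
-/

noncomputable section

namespace Summit.AtomisticToContinuum.Crystallization.Theorems

open Literature.Geometry.DiscreteGeometry

/-- Euclidean `3`-space. -/
local notation "E3" => EuclideanSpace ℝ (Fin 3)

set_option quotPrecheck false in
/-- The ring point `(√3/2·cos(2πk/5), √3/2·sin(2πk/5), σ)` of the decahedral pattern. -/
local notation "RING[" k ", " σ "]" =>
  (WithLp.toLp 2 (V := ∀ _ : Fin 3, ℝ)
    ![Real.sqrt 3 / 2 * Real.cos (2 * Real.pi * ((k : Fin 5) : ℝ) / 5),
      Real.sqrt 3 / 2 * Real.sin (2 * Real.pi * ((k : Fin 5) : ℝ) / 5), σ] :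
    EuclideanSpace ℝ (Fin 3))

set_option quotPrecheck false in
/-- The decahedral pattern (bicapped pentagonal prism), verbatim as in the crux statement. -/
local notation "DECA" =>
  ({p : EuclideanSpace ℝ (Fin 3) | p = !₂[(0 : ℝ), 0, 1] ∨ p = !₂[(0 : ℝ), 0, -1] ∨
    ∃ k : Fin 5, ∃ σ : ℝ, (σ = 1 / 2 ∨ σ = -(1 / 2)) ∧
      p = !₂[Real.sqrt 3 / 2 * Real.cos (2 * Real.pi * (k : ℝ) / 5),
        Real.sqrt 3 / 2 * Real.sin (2 * Real.pi * (k : ℝ) / 5), σ]} :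
    Set (EuclideanSpace ℝ (Fin 3)))

/-! ### Trigonometry of the fifth roots of unity -/

/-- `cos 5θ` as a polynomial in `cos θ` (Chebyshev `T₅`). -/
theorem dr5pl_cos_five_mul (θ : ℝ) :
    Real.cos (5 * θ) = 16 * Real.cos θ ^ 5 - 20 * Real.cos θ ^ 3 + 5 * Real.cos θ := by
  have h : (5 : ℝ) * θ = 2 * θ + 3 * θ := by ring
  rw [h, Real.cos_add, Real.cos_two_mul, Real.sin_two_mul, Real.cos_three_mul, Real.sin_three_mul]
  linear_combination (8 * Real.cos θ * Real.sin θ ^ 2 + 2 * Real.cos θ - 8 * Real.cos θ ^ 3) *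
    Real.sin_sq_add_cos_sq θ

/-- For a natural `m`, `c = cos(2πm/5)` is `1` or a root of `4c² + 2c - 1`. -/
theorem dr5pl_cos_root (m : ℕ) :
    Real.cos (2 * Real.pi * (m : ℝ) / 5) = 1 ∨
      4 * Real.cos (2 * Real.pi * (m : ℝ) / 5) ^ 2 +
        2 * Real.cos (2 * Real.pi * (m : ℝ) / 5) - 1 = 0 := by
  set c := Real.cos (2 * Real.pi * (m : ℝ) / 5) with hc
  have h5 : Real.cos (5 * (2 * Real.pi * (m : ℝ) / 5)) = 1 := by
    have : 5 * (2 * Real.pi * (m : ℝ) / 5) = (m : ℝ) * (2 * Real.pi) := by ring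
    rw [this, Real.cos_nat_mul_two_pi]
  rw [dr5pl_cos_five_mul] at h5
  have hfac : (c - 1) * (4 * c ^ 2 + 2 * c - 1) ^ 2 = 0 := by linear_combination h5
  rcases mul_eq_zero.1 hfac with h | h
  · left; linarith
  · right; exact (pow_eq_zero_iff (n := 2) (by norm_num)).1 h

/-- For `k : Fin 5`, `k ≠ 0`: `cos(2πk/5) ≤ 9/25` (the true values are `(√5-1)/4 ≈ 0.309` and
`-(√5+1)/4`). -/
theorem dr5pl_cos_le_of_ne_zero (k : Fin 5) (hk : k ≠ 0) :
    Real.cos (2 * Real.pi * (k : ℝ) / 5) ≤ 9 / 25 := by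
  rcases dr5pl_cos_root (k : ℕ) with h | h
  · exfalso
    have hk1 : (1 : ℝ) ≤ (k : ℕ) := by
      have : 1 ≤ (k : ℕ) := Nat.one_le_iff_ne_zero.2 fun h0 => hk (Fin.ext h0)
      exact_mod_cast this
    have hk4 : ((k : ℕ) : ℝ) ≤ 4 := by
      have : (k : ℕ) ≤ 4 := Nat.lt_succ_iff.1 k.isLt
      exact_mod_cast this
    have hlo : -(2 * Real.pi) < 2 * Real.pi * ((k : ℕ) : ℝ) / 5 := by
      nlinarith [Real.pi_pos]
    have hhi : 2 * Real.pi * ((k : ℕ) : ℝ) / 5 < 2 * Real.pi := by nlinarith [Real.pi_pos]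
    have h0 := (Real.cos_eq_one_iff_of_lt_of_lt hlo hhi).1 h
    have : (0 : ℝ) < 2 * Real.pi * ((k : ℕ) : ℝ) / 5 := by positivity
    linarith
  · nlinarith

/-- For `k : Fin 5` with `k = 2` or `k = 3`: `cos(2πk/5) ≤ -4/5` (true value `-(√5+1)/4`). -/
theorem dr5pl_cos_le_of_two_three (k : Fin 5) (hk : k = 2 ∨ k = 3) :
    Real.cos (2 * Real.pi * (k : ℝ) / 5) ≤ -4 / 5 := by
  have hk2 : (2 : ℝ) ≤ (k : ℕ) := by
    rcases hk with rfl | rfl <;> norm_num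
  have hk3 : ((k : ℕ) : ℝ) ≤ 3 := by
    rcases hk with rfl | rfl <;> norm_num
  have hneg : Real.cos (2 * Real.pi * (k : ℝ) / 5) < 0 := by
    apply Real.cos_neg_of_pi_div_two_lt_of_lt
    · nlinarith [Real.pi_pos]
    · nlinarith [Real.pi_pos]
  rcases dr5pl_cos_root (k : ℕ) with h | h
  · linarith
  · nlinarith

/-- Angle differences reduce to subtraction in `Fin 5`, for `cos` and `sin`. -/
theorem dr5pl_cos_sin_sub (j k : Fin 5) :
    Real.cos (2 * Real.pi * (j : ℝ) / 5 - 2 * Real.pi * (k : ℝ) / 5) =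
        Real.cos (2 * Real.pi * ((j - k : Fin 5) : ℝ) / 5) ∧
      Real.sin (2 * Real.pi * (j : ℝ) / 5 - 2 * Real.pi * (k : ℝ) / 5) =
        Real.sin (2 * Real.pi * ((j - k : Fin 5) : ℝ) / 5) := by
  rcases le_or_gt k j with h | h
  · have hv : ((j - k : Fin 5) : ℕ) = (j : ℕ) - (k : ℕ) := Fin.coe_sub_iff_le.2 h
    have hc : (((j - k : Fin 5) : ℕ) : ℝ) = (j : ℕ) - (k : ℕ) := by
      rw [hv]; push_cast [Fin.le_def.1 h]; ring
    rw [hc]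
    constructor <;> congr 1 <;> ring
  · have hv : ((j - k : Fin 5) : ℕ) = 5 + (j : ℕ) - (k : ℕ) := Fin.coe_sub_iff_lt.2 h
    have hk5 : (k : ℕ) ≤ 5 + (j : ℕ) := by have := k.isLt; omega
    have hc : (((j - k : Fin 5) : ℕ) : ℝ) = 5 + (j : ℕ) - (k : ℕ) := by
      rw [hv]; push_cast [hk5]; ring
    rw [hc]
    have harg : 2 * Real.pi * (5 + ((j : ℕ) : ℝ) - (k : ℕ)) / 5 =
        (2 * Real.pi * (j : ℝ) / 5 - 2 * Real.pi * (k : ℝ) / 5) + 2 * Real.pi := by ring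
    rw [harg, Real.cos_add_two_pi, Real.sin_add_two_pi]
    exact ⟨rfl, rfl⟩

/-- Every `k : Fin 5` is one of `k₀, k₀ ± 1, k₀ ± 2`. -/
theorem dr5pl_fin5_cover (k₀ k : Fin 5) :
    k = k₀ ∨ k = k₀ + 1 ∨ k = k₀ - 1 ∨ k = k₀ + 2 ∨ k = k₀ - 2 := by
  fin_cases k₀ <;> fin_cases k <;> decide

/-! ### Distances in the decahedral pattern -/

/-- Squared distance between two ring points. -/
theorem dr5pl_ring_dist_sq (j k : Fin 5) (σ τ : ℝ) :
    dist RING[j, σ] RING[k, τ] ^ 2 =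
      3 / 2 * (1 - Real.cos (2 * Real.pi * ((j - k : Fin 5) : ℝ) / 5)) + (σ - τ) ^ 2 := by
  rw [← (dr5pl_cos_sin_sub j k).1, EuclideanSpace.dist_eq,
    Real.sq_sqrt (Finset.sum_nonneg fun i _ => sq_nonneg _), Fin.sum_univ_three]
  simp [Real.dist_eq]
  rw [Real.cos_sub]
  have h3 : Real.sqrt 3 ^ 2 = 3 := Real.sq_sqrt (by norm_num)
  nlinarith [Real.sin_sq_add_cos_sq (2 * Real.pi * (j : ℝ) / 5),
    Real.sin_sq_add_cos_sq (2 * Real.pi * (k : ℝ) / 5)]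

/-- Squared distance from a ring point to the point `(0, 0, s)` of the axis. -/
theorem dr5pl_ring_axis_dist_sq (k : Fin 5) (σ s : ℝ) :
    dist RING[k, σ] (!₂[(0 : ℝ), 0, s] : E3) ^ 2 = 3 / 4 + (σ - s) ^ 2 := by
  rw [EuclideanSpace.dist_eq, Real.sq_sqrt (Finset.sum_nonneg fun i _ => sq_nonneg _),
    Fin.sum_univ_three]
  simp [Real.dist_eq, mul_pow, div_pow]
  have h3 : Real.sqrt 3 ^ 2 = 3 := Real.sq_sqrt (by norm_num)
  nlinarith [Real.sin_sq_add_cos_sq (2 * Real.pi * (k : ℝ) / 5)]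

/-- Two ring points with the same angle label and height coincide only trivially: equal ring
points have equal labels. -/
theorem dr5pl_ring_inj {j k : Fin 5} {σ τ : ℝ} (h : RING[j, σ] = RING[k, τ]) : j = k ∧ σ = τ := by
  have hd := dr5pl_ring_dist_sq j k σ τ
  rw [h, dist_self] at hd
  have hστ : σ = τ := by
    nlinarith [Real.cos_le_one (2 * Real.pi * ((j - k : Fin 5) : ℝ) / 5), sq_nonneg (σ - τ)]
  refine ⟨?_, hστ⟩
  by_contra hjk
  have hne : (j - k : Fin 5) ≠ 0 := sub_ne_zero.2 hjk
  have := dr5pl_cos_le_of_ne_zero (j - k) hne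
  nlinarith [sq_nonneg (σ - τ)]

/-! ### Near neighbours of a ring point, and the decahedral valence fact -/

/-- The points of `Deca` other than the ring point `v = r(k₀, σ₀)` at distance `< 7/5` from it are
among: its pole, its partner `r(k₀, -σ₀)` and its two ring-mates `r(k₀ ± 1, σ₀)`. -/
theorem dr5pl_near_ring (k₀ : Fin 5) (σ₀ : ℝ) (hσ₀ : σ₀ = 1 / 2 ∨ σ₀ = -(1 / 2)) (w : E3)
    (hw : w ∈ DECA) (hne : w ≠ RING[k₀, σ₀]) (hd : dist w RING[k₀, σ₀] < 7 / 5) :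
    w ∈ ({!₂[(0 : ℝ), 0, 2 * σ₀], RING[k₀, -σ₀], RING[k₀ + 1, σ₀], RING[k₀ - 1, σ₀]} :
      Finset E3) := by
  simp only [Finset.mem_insert, Finset.mem_singleton]
  have hd2 : dist w RING[k₀, σ₀] ^ 2 < 49 / 25 := by
    nlinarith [dist_nonneg (x := w) (y := RING[k₀, σ₀])]
  rcases hw with rfl | rfl | ⟨k, σ, hσ, rfl⟩
  · rcases hσ₀ with rfl | rfl
    · left; norm_num
    · rw [dist_comm, dr5pl_ring_axis_dist_sq] at hd2
      norm_num at hd2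
  · rcases hσ₀ with rfl | rfl
    · rw [dist_comm, dr5pl_ring_axis_dist_sq] at hd2
      norm_num at hd2
    · left; norm_num
  · rw [dr5pl_ring_dist_sq] at hd2
    have hsq : σ ≠ σ₀ → (σ - σ₀) ^ 2 = 1 := by
      intro h
      rcases hσ with rfl | rfl <;> rcases hσ₀ with rfl | rfl <;>
        first | exact absurd rfl h | norm_num
    rcases dr5pl_fin5_cover k₀ k with rfl | rfl | rfl | rfl | rfl
    · have hσne : σ ≠ σ₀ := fun h => hne (by rw [h])
      have hσ' : σ = -σ₀ := by
        rcases hσ with rfl | rfl <;> rcases hσ₀ with rfl | rfl <;>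
          first | exact absurd rfl hσne | norm_num
      right; left; rw [hσ']
    · rw [add_sub_cancel_left] at hd2
      have hc := dr5pl_cos_le_of_ne_zero 1 (by decide)
      have hσeq : σ = σ₀ := by
        by_contra h
        have := hsq h
        nlinarith
      subst hσeq
      right; right; left; rfl
    · rw [sub_sub_cancel_left] at hd2
      have hc := dr5pl_cos_le_of_ne_zero (-1) (by decide)
      have hσeq : σ = σ₀ := by
        by_contra h
        have := hsq h
        nlinarith
      subst hσeq
      right; right; right; rfl
    · rw [add_sub_cancel_left] at hd2
      have hc := dr5pl_cos_le_of_two_three 2 (by decide)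
      nlinarith [sq_nonneg (σ - σ₀)]
    · rw [sub_sub_cancel_left] at hd2
      have hc := dr5pl_cos_le_of_two_three (-2) (by decide)
      nlinarith [sq_nonneg (σ - σ₀)]

/-- Pigeonhole: no injection of `Fin 5` into a finset with at most four elements. -/
theorem dr5pl_pigeonhole {α : Type*} [DecidableEq α] (s : Finset α) (hs : s.card ≤ 4)
    (g : Fin 5 → α) (hg : Function.Injective g) (h : ∀ i, g i ∈ s) : False := by
  have h1 : (Finset.univ.image g).card = 5 := by
    rw [Finset.card_image_of_injective _ hg]; simp
  have h2 : Finset.univ.image g ⊆ s := by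
    intro x hx
    obtain ⟨i, -, rfl⟩ := Finset.mem_image.1 hx
    exact h i
  have := Finset.card_le_card h2
  omega

/-- **Valence fact for `Deca`** (registered helper stub, one-line signature). If five distinct
points of `Deca` other than `v ∈ Deca` lie at distance `< 7/5` from `v`, then `v` is a pole. -/
theorem dr5pl_deca_valence : ∀ {v : EuclideanSpace ℝ (Fin 3)}, v ∈ {p : EuclideanSpace ℝ (Fin 3) | p = !₂[(0 : ℝ), 0, 1] ∨ p = !₂[(0 : ℝ), 0, -1] ∨ ∃ k : Fin 5, ∃ σ : ℝ, (σ = 1 / 2 ∨ σ = -(1 / 2)) ∧ p = !₂[Real.sqrt 3 / 2 * Real.cos (2 * Real.pi * (k : ℝ) / 5), Real.sqrt 3 / 2 * Real.sin (2 * Real.pi * (k : ℝ) / 5), σ]} → ∀ {g : Fin 5 → EuclideanSpace ℝ (Fin 3)}, Function.Injective g → (∀ i, g i ∈ {p : EuclideanSpace ℝ (Fin 3) | p = !₂[(0 : ℝ), 0, 1] ∨ p = !₂[(0 : ℝ), 0, -1] ∨ ∃ k : Fin 5, ∃ σ : ℝ, (σ = 1 / 2 ∨ σ = -(1 / 2))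 ∧ p = !₂[Real.sqrt 3 / 2 * Real.cos (2 * Real.pi * (k : ℝ) / 5), Real.sqrt 3 / 2 * Real.sin (2 * Real.pi * (k : ℝ) / 5), σ]}) → (∀ i, g i ≠ v) → (∀ i, dist (g i) v < 7 / 5) → v = !₂[(0 : ℝ), 0, 1] ∨ v = !₂[(0 : ℝ), 0, -1] := by
  intro v hv g hg hmem hne hd
  rcases hv with h | h | ⟨k₀, σ₀, hσ₀, rfl⟩
  · exact Or.inl h
  · exact Or.inr h
  · exact (dr5pl_pigeonhole _ Finset.card_le_four g hg fun i =>
      dr5pl_near_ring k₀ σ₀ hσ₀ (g i) (hmem i) (hne i) (hd i)).elim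

/-! ### Valence facts for the fcc and hcp patterns -/

/-- In the cuboctahedron integer model every vertex has at most four others at squared distance
`≤ 3` (i.e. `< 2·(7/5)²` after scaling by `1/√2`). -/
theorem dr5pl_fccInt_count :
    ∀ a ∈ fccInt, (fccInt.filter fun b => b ≠ a ∧ sqNormInt (b - a) ≤ 3).card ≤ 4 := by decide

/-- In the anticuboctahedron integer model every vertex has at most four others at squared
distance `≤ 35` (i.e. `< 18·(7/5)²` after scaling by `1/√18`). -/
theorem dr5pl_hcpInt_count :
    ∀ a ∈ hcpInt, (hcpInt.filter fun b => b ≠ a ∧ sqNormInt (b - a) ≤ 35).card ≤ 4 := by decide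

/-- Generic valence fact for a scaled integer pattern: if every integer vertex has at most four
others at squared distance `≤ M`, where `49·N ≤ 25·(M+1)`, then among five distinct points of the
scaled pattern other than `v` one is at distance `≥ 7/5` from `v`. -/
theorem dr5pl_scaled_valence {P : Finset (Fin 3 → ℤ)} {N : ℕ} (hN : N ≠ 0) {M : ℤ}
    (hM : (49 : ℝ) * N ≤ 25 * ((M : ℝ) + 1))
    (hcount : ∀ a ∈ P, (P.filter fun b => b ≠ a ∧ sqNormInt (b - a) ≤ M).card ≤ 4)
    {v : E3} (hv : v ∈ scaledPattern P N) {g : Fin 5 → E3} (hg : Function.Injective g)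
    (hmem : ∀ i, g i ∈ scaledPattern P N) (hne : ∀ i, g i ≠ v) :
    ∃ i, (7 / 5 : ℝ) ≤ dist (g i) v := by
  by_contra hcon
  push Not at hcon
  obtain ⟨a, ha, rfl⟩ := Finset.mem_image.1 hv
  have hb : ∀ i, ∃ b ∈ P, (Real.sqrt N)⁻¹ • intVec b = g i := fun i =>
    Finset.mem_image.1 (hmem i)
  choose b hbP hbg using hb
  have hpos : (0 : ℝ) < Real.sqrt N := Real.sqrt_pos.2 (by exact_mod_cast Nat.pos_of_ne_zero hN)
  refine dr5pl_pigeonhole _ (hcount a ha) b ?_ ?_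
  · intro i j hij
    apply hg
    rw [← hbg i, ← hbg j, hij]
  · intro i
    refine Finset.mem_filter.2 ⟨hbP i, ?_, ?_⟩
    · intro hba
      exact hne i (by rw [← hbg i, hba])
    · have h := hcon i
      rw [← hbg i, dist_eq_norm, ← smul_sub, intVec_sub, norm_smul, norm_inv,
        Real.norm_of_nonneg hpos.le, norm_intVec, inv_mul_lt_iff₀ hpos] at h
      have hq0 : 0 ≤ sqNormInt (b i - a) := by unfold sqNormInt; positivity
      have hq : (0 : ℝ) ≤ sqNormInt (b i - a) := by exact_mod_cast hq0
      have h3 : (sqNormInt (b i - a) : ℝ) < (Real.sqrt N * (7 / 5)) ^ 2 :=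
        (Real.sqrt_lt' (by positivity)).1 h
      rw [mul_pow, Real.sq_sqrt (Nat.cast_nonneg N)] at h3
      have h4 : (sqNormInt (b i - a) : ℝ) < M + 1 := by linarith
      have h5 : sqNormInt (b i - a) < M + 1 := by exact_mod_cast h4
      omega

/-- **Valence fact for the fcc pattern** (cuboctahedron): among five distinct vertices other
than `v` one is at distance `≥ 7/5` (in fact `√2`) from `v`. -/
theorem dr5pl_fcc_valence {v : E3} (hv : v ∈ fccKissingPattern) {g : Fin 5 → E3}
    (hg : Function.Injective g) (hmem : ∀ i, g i ∈ fccKissingPattern) (hne : ∀ i, g i ≠ v) :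
    ∃ i, (7 / 5 : ℝ) ≤ dist (g i) v :=
  dr5pl_scaled_valence (P := fccInt) two_ne_zero (M := 3) (by norm_num) dr5pl_fccInt_count hv hg
    hmem hne

/-- **Valence fact for the hcp pattern** (anticuboctahedron). -/
theorem dr5pl_hcp_valence {v : E3} (hv : v ∈ hcpKissingPattern) {g : Fin 5 → E3}
    (hg : Function.Injective g) (hmem : ∀ i, g i ∈ hcpKissingPattern) (hne : ∀ i, g i ≠ v) :
    ∃ i, (7 / 5 : ℝ) ≤ dist (g i) v :=
  dr5pl_scaled_valence (P := hcpInt) (N := 18) (by norm_num) (M := 35) (by norm_num)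
    dr5pl_hcpInt_count hv hg hmem hne

/-! ### The flip `(a, b, c) ↦ (a, -b, -c)` -/

/-- The half-turn about the first axis, as a linear isometry: an involution. -/
theorem dr5pl_flip :
    ∃ F : E3 ≃ₗᵢ[ℝ] E3, (∀ x, F (F x) = x) ∧ ∀ x : E3, F x = !₂[x 0, -x 1, -x 2] := by
  refine ⟨(Submodule.span ℝ {EuclideanSpace.single (0 : Fin 3) (1 : ℝ)}).reflection,
    fun x => Submodule.reflection_reflection _ x, fun x => ?_⟩
  rw [Submodule.reflection_singleton_apply]
  simp [EuclideanSpace.inner_single_left]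
  ext i
  fin_cases i <;> simp
  ring

/-- The flip maps the ring point `r(k, σ)` to `r(-k, -σ)`. -/
theorem dr5pl_flip_ring (F : E3 ≃ₗᵢ[ℝ] E3) (hF : ∀ x : E3, F x = !₂[x 0, -x 1, -x 2]) (k : Fin 5)
    (σ : ℝ) : F RING[k, σ] = RING[-k, -σ] := by
  have h := dr5pl_cos_sin_sub 0 k
  rw [zero_sub] at h
  have h0 : 2 * Real.pi * ((0 : Fin 5) : ℝ) / 5 = 0 := by simp
  rw [h0, zero_sub, Real.cos_neg, Real.sin_neg] at h
  rw [hF, ← h.1, ← h.2]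
  ext i
  fin_cases i <;> simp

/-- The flip preserves the decahedral pattern. -/
theorem dr5pl_flip_deca (F : E3 ≃ₗᵢ[ℝ] E3) (hF : ∀ x : E3, F x = !₂[x 0, -x 1, -x 2]) (q : E3)
    (hq : q ∈ DECA) : F q ∈ DECA := by
  rcases hq with rfl | rfl | ⟨k, σ, hσ, rfl⟩
  · right; left
    rw [hF]; ext i; fin_cases i <;> simp
  · left
    rw [hF]; ext i; fin_cases i <;> simp
  · right; right
    refine ⟨-k, -σ, ?_, dr5pl_flip_ring F hF k σ⟩
    rcases hσ with rfl | rfl <;> norm_num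

/-- The flip negates the poles. -/
theorem dr5pl_flip_pole (F : E3 ≃ₗᵢ[ℝ] E3) (hF : ∀ x : E3, F x = !₂[x 0, -x 1, -x 2]) (v : E3)
    (hv : v = !₂[(0 : ℝ), 0, 1] ∨ v = !₂[(0 : ℝ), 0, -1]) : F v = -v := by
  rcases hv with rfl | rfl <;> · rw [hF]; ext i; fin_cases i <;> simp

/-- `-(0,0,1) = (0,0,-1)`. -/
theorem dr5pl_neg_north : -(!₂[(0 : ℝ), 0, 1] : E3) = !₂[(0 : ℝ), 0, -1] := by
  ext i; fin_cases i <;> simp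

/-- `-(0,0,-1) = (0,0,1)`. -/
theorem dr5pl_neg_south : -(!₂[(0 : ℝ), 0, -1] : E3) = !₂[(0 : ℝ), 0, 1] := by
  ext i; fin_cases i <;> simp

/-- The distance from a ring point to the pole on its side is `1`. -/
theorem dr5pl_ring_pole_dist (k : Fin 5) (s : ℝ) (hs : s = 1 ∨ s = -1) :
    dist RING[k, s / 2] (!₂[(0 : ℝ), 0, s] : E3) = 1 := by
  have h := dr5pl_ring_axis_dist_sq k (s / 2) s
  have h1 : dist RING[k, s / 2] (!₂[(0 : ℝ), 0, s] : E3) ^ 2 = 1 := by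
    rw [h]; rcases hs with rfl | rfl <;> norm_num
  have h0 : (0 : ℝ) ≤ dist RING[k, s / 2] (!₂[(0 : ℝ), 0, s] : E3) := dist_nonneg
  nlinarith

end Summit.AtomisticToContinuum.Crystallization.Theorems

end
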